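import Literature.MathematicalPhysics.QuantumFieldTheory.Balaban1983to89.Beta.AveragingHessianKernels
import Literature.MathematicalPhysics.QuantumFieldTheory.Balaban1983to89.Beta.AveragingContoursRooted

/-!
# `Balaban1983to89.Beta.AveragingHessianKernelsRooted` — node 7a's second-order averaging kernels `q¹_b, h_b, m_b`
# and their `LocStencil`/`BiLoc` packings for the block contours with a GENERIC ROOT OFFSET `ρ` (node 5ρ), v1

HONEST FRAMING (page 1, mandatory).  This leaf belongs to the β sub-cell of the Bałaban audit, whose END STATEMENT is:
discharging the one-loop hypothesis `FlowStep.BetaPertH` makes Bałaban's ultraviolet stability theorem for 4-d lattice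
Yang–Mills ([Balaban1989LargeFieldII], Thm. 1 p. 355) UNCONDITIONAL inside this package — a real constructive-QFT result;
it is NOT the continuum limit and NOT the Clay problem.  EVERYTHING below is kernel-proved [folklore] algebra of finite
letter lists, finite sums on `ℤ^d` and elementary real estimates; NOTHING is cited as a fact.

ABSOLUTE RULE (cell charter, verbatim): «No internally-minted statement may enter as a cited fact. Every hypothesis is
either kernel-proved in this package or a verbatim quotation of a PUBLISHED theorem with page reference. The manuscript(s)
under audit are NOT citable for their own disputed steps — they are the thing under adjudication; programme-internal
(2001/route/tribunal) claims are never citable.»  Accordingly NO declaration below is a `def … : Prop` carrying a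
citation and no hypothesis of any theorem is a printed statement: every declaration is [folklore]; the quotations are
object LOCATORS only (they are those of node 7a `Beta.AveragingHessianKernels` and node 5 `Beta.AveragingContours`,
XREAD-verified there: [Balaban1985Averaging] (B7) p.19 (14)/(15), (11); [Balaban1984PropagatorsI] (B5-I) p.18–19
(1.6)–(1.11); and for the centred root [Balaban1987RG1] (B12) p.251 «L is an odd, positive integer … a lattice of
centers of these cubes», p.252 (0.3)).

WHY THIS LEAF (β-lead RULING (R32), journal 2026-08-19 l.304, item (R32-4): «the root parameter ρ (or centred twins) for
node 5 `gammaC`/`loopC` AND THE COUNTS/KERNELS ABOVE IT — cheapest faithful form first»).  Node 5ρ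
(`Beta.AveragingContoursRooted`) typed the contour system `gammaCAt ρ / loopCAt ρ / linAvgAt ρ` with the root `L·y`
of node 5 replaced by `L·y + ρ`.  THIS LEAF is node 7a over those contours: the SAME three letter functionals and the
SAME three integer count kernels, instantiated on the letter lists of `loopCAt ρ` and on the straight coarse bond FROM
THE ROOT `[L·y + ρ, L·y + ρ + L·e_μ]`, with node 7a's proofs re-run line by line; node 7a's list-generic algebra
(`comm/cross/diag/wedge/smulPair`, `single/δ1`, `LettersIn/Near/Hull`, `Bond.sh`, `ell`, and the PACKER `packVH` with
its two structural theorems `locStencil_packVH` / `packVH_translate`) is used BY NAME, never restated.  At second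
order re-rooting is NOT a coarse gauge transformation (the loop words change — node 5ρ's `example_gammaCAt` vs
`example_gammaC_corner`), so unlike the linear order (node 5ρ `linAvgAt_eq_linAvg_add`) there is no shortcut: the
counts are re-instantiated, as (R32-4) asks.  Nothing of node 7a is edited or re-proposed; the `ρ = 0` instances are
identified with node 7a's declarations BY NAME (§9).

WHAT IS TYPED (`ρ : Site d` arbitrary unless a hypothesis says `ρ = toSite r`, `r ∈ box` — «the root lies in its own
block», which is where the support box `Near L y` of node 7a still contains every letter).
* §1 naturality of the rooted lists in the coefficients (`gammaCAt_map`, `loopCAt_map`, `linAvgAt_mapForm`, pair swap).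
* §2 the rooted letter functionals `hessUAt ρ W W′ L μ y` (closed loop words over `loopCAt ρ`, `Z = linAvgAt ρ`, coarse
  bond from the root) and `vhUAt ρ W B L μ y` (product chart), `hessUAt_symm`.
* §3 the rooted integer kernels `linCountAt ρ`, `cCountAt ρ`, `hessCountAt ρ`, `vhCountAt ρ` and the single-bond
  IDENTIFICATION theorems `linAvgAt_single`, `hessUAt_single`, `vhUAt_single` (node 7a's scripts), antisymmetry.
* §4 support in node 7a's box `Near L y` for a root offset in the box; FINITE RANGE of the three kernels.
* §5 entry bounds (`|q¹| ≤ L^d ℓ`, `|h| ≤ 4L^d ℓ²`, `|m| ≤ 6L^{2d} ℓ²`, `ℓ = (2d+2)L` = node 7a's `ell`).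
* §6 BLOCK-TRANSLATION covariance `y ↦ y + t`, bonds shifted by `L·t`, ROOT OFFSET FIXED (all ρ).
* §7 the real kernels `linKerAt/hessKerAt/vhKerAt ρ` (same normalisations `L^{−d}`, `(2L^d)^{−1}`, `(2L^{2d})^{−1}`).
* §8 PACKING with node 7a's `packVH`: `vhSAt ρ d L`, `vhSaddAt ρ d L` (`LocStencil` for every `δ ≥ 0`, same constants as
  7a, for a box root; block-translation law for all ρ), `hessFFAt ρ L μ y` on the `(inl, inl)` block (antisymmetric;
  `BiLoc` at the coarse site's fine image `L·y` AND at the fine root `L·y + ρ`, same constant; translation law) — the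
  byte shapes of node 7a's `locStencil_vhS`, `vhS_translate`, `biLoc_hessFF`, `hessFF_translate` with `At ρ` inserted.
* §9 BRIDGES `…At 0 = node 7a` for every object (`hessUAt_zero`, `vhUAt_zero`, `linCountAt_zero`, `cCountAt_zero`,
  `hessCountAt_zero`, `vhCountAt_zero`, `linKerAt_zero`, `hessKerAt_zero`, `vhKerAt_zero`, `vhSAt_zero`, `vhSaddAt_zero`,
  `hessFFAt_zero`).
* §10 decided toy tables (`d = 1`, `L = 3`, centred root `ρ = 1`): the rooted counts vs node 7a's corner-rooted ones.
NOT HERE: the identification of `hessUAt`/`vhUAt` with the ray jets of the ROOTED (15) (node 7b's `engine` is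
list-generic; the rooted §5 of 7b is the next stone, «7bρ»), the third/mixed jets (12b), reflections (an5), anything
printed.  NOT continuum; NOT Clay.

Provenance: b2b-balaban β sub-cell, unit beta-an1 gen 13 (node 7aρ AVERAGING-HESSIAN-KERNELS-ROOTED), 2026-08-19; over
node 7a `Beta.AveragingHessianKernels` v1.0.2 and node 5ρ `Beta.AveragingContoursRooted` v1 BY NAME.  Bib keys (locators
only): Balaban1984PropagatorsI, Balaban1985Averaging, Balaban1987RG1, Balaban1989LargeFieldII.
-/

namespace Literature.MathematicalPhysics.QuantumFieldTheory.Balaban1983to89.Beta.AveragingHessianKernelsRooted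

open Finset
open Literature.MathematicalPhysics.QuantumFieldTheory.Balaban1983to89.Beta.AffineAveraging
open Literature.MathematicalPhysics.QuantumFieldTheory.Balaban1983to89.Beta.AveragingContours
open Literature.MathematicalPhysics.QuantumFieldTheory.Balaban1983to89.Beta.AveragingContoursRooted
open Literature.MathematicalPhysics.QuantumFieldTheory.Balaban1983to89.Beta.TransportedContourVariables
open Literature.MathematicalPhysics.QuantumFieldTheory.Balaban1983to89.Beta.AveragingHessianKernels

/-! ## §1 Naturality of the rooted letter lists -/

section Naturality

variable {d : ℕ} {R R' : Type*} [AddCommGroup R] [AddCommGroup R']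

/-- [folklore] Naturality of `gammaCAt` in the coefficients. -/
theorem gammaCAt_map (f : R →+ R') (ρ : Fin d → ℤ) (A : Form1 d R) (L : ℕ) (μ : Fin d) (y : Fin d → ℤ)
    (b : Fin d → ℕ) : (gammaCAt ρ A L μ y b).map f = gammaCAt ρ (mapForm f A) L μ y b := by
  simp only [gammaCAt, List.map_append, axial_map, segUp_map, rev_map]

/-- [folklore] Naturality of `loopCAt` in the coefficients. -/
theorem loopCAt_map (f : R →+ R') (ρ : Fin d → ℤ) (A : Form1 d R) (L : ℕ) (μ : Fin d) (y : Fin d → ℤ)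
    (b : Fin d → ℕ) : (loopCAt ρ A L μ y b).map f = loopCAt ρ (mapForm f A) L μ y b := by
  simp only [loopCAt, List.map_append, gammaCAt_map, segUp_map, rev_map]

/-- [folklore] Naturality of `linAvgAt` in the coefficients. -/
theorem linAvgAt_mapForm (φ : R →+ R') (ρ : Fin d → ℤ) (A : Form1 d R) (L : ℕ) (μ : Fin d) (y : Fin d → ℤ) :
    linAvgAt ρ (mapForm φ A) L μ y = φ (linAvgAt ρ A L μ y) := by
  simp only [linAvgAt, ← gammaCAt_map, map_sum, map_list_sum]

end Naturality

/-! ## §2 The rooted letter functionals at `U = 1` (unnormalised, over any ring) -/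

section Functionals

variable {d : ℕ} {𝔸 : Type*} [Ring 𝔸]

/-- [folklore] THE ROOTED UNNORMALISED W-HESSIAN FUNCTIONAL: node 7a's `hessU` with the closed loops `loopCAt ρ`, the
rooted linear averaging `Z = linAvgAt ρ` and the straight coarse bond from the root `[L·y + ρ, L·y + ρ + L·e_μ]`. -/
def hessUAt (ρ : Fin d → ℤ) (W W' : Form1 d 𝔸) (L : ℕ) (μ : Fin d) (y : Fin d → ℤ) : 𝔸 :=
  (∑ b ∈ box d L, cross (loopCAt ρ (pairForm W W') L μ y b))
    + (comm (linAvgAt ρ W L μ y) (segUp W' ((L : ℤ) • y + ρ) μ L).sum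
        + comm (linAvgAt ρ W' L μ y) (segUp W ((L : ℤ) • y + ρ) μ L).sum)
    + ((L : ℤ) ^ d) • cross (segUp (pairForm W W') ((L : ℤ) • y + ρ) μ L)

/-- [folklore] THE ROOTED UNNORMALISED FIELD–MULTIPLIER FUNCTIONAL in the product chart `U = e^W e^B`. -/
def vhUAt (ρ : Fin d → ℤ) (W B : Form1 d 𝔸) (L : ℕ) (μ : Fin d) (y : Fin d → ℤ) : 𝔸 :=
  ((L : ℤ) ^ d) • hessUAt ρ W B L μ y + ((L : ℤ) ^ d) • linAvgAt ρ (bw W B) L μ y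
    - comm (linAvgAt ρ W L μ y) (linAvgAt ρ B L μ y)

/-- [folklore] Swapping the pair form swaps the letters of the rooted loop lists. -/
theorem loopCAt_pairForm_swap (ρ : Fin d → ℤ) (W W' : Form1 d 𝔸) (L : ℕ) (μ : Fin d) (y : Fin d → ℤ)
    (b : Fin d → ℕ) : loopCAt ρ (pairForm W' W) L μ y b = (loopCAt ρ (pairForm W W') L μ y b).map Prod.swap := by
  rw [pairForm_swap, ← loopCAt_map]; rfl

/-- [folklore] **The rooted W-Hessian functional is symmetric.** -/
theorem hessUAt_symm (ρ : Fin d → ℤ) (W W' : Form1 d 𝔸) (L : ℕ) (μ : Fin d) (y : Fin d → ℤ) :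
    hessUAt ρ W' W L μ y = hessUAt ρ W W' L μ y := by
  simp only [hessUAt, loopCAt_pairForm_swap ρ W W', segUp_pairForm_swap W W', cross_swap]
  abel

end Functionals

/-! ## §3 The rooted integer count kernels and the single-bond identification theorems -/

section Counts

variable {d : ℕ}

/-- [folklore] `q¹` UNNORMALISED, rooted: `linCountAt ρ L μ y f = linAvgAt ρ δ_f` = the signed number of passages of
the rooted contours `Γ^ρ_{c,x}`, `x ∈ B(y)`, through the bond `f`. -/
def linCountAt (ρ : Fin d → ℤ) (L : ℕ) (μ : Fin d) (y : Fin d → ℤ) (f : Bond d) : ℤ := linAvgAt ρ (δ1 f) L μ y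

/-- [folklore] The signed multiplicity of `f` on the straight coarse bond FROM THE ROOT. -/
def cCountAt (ρ : Fin d → ℤ) (L : ℕ) (μ : Fin d) (y : Fin d → ℤ) (f : Bond d) : ℤ :=
  (segUp (δ1 f) ((L : ℤ) • y + ρ) μ L).sum

/-- [folklore] `h` UNNORMALISED, rooted (`= 2L^d · h^ρ_b(f, f′)`). -/
def hessCountAt (ρ : Fin d → ℤ) (L : ℕ) (μ : Fin d) (y : Fin d → ℤ) (f f' : Bond d) : ℤ :=
  (∑ b ∈ box d L, wedge (loopCAt ρ (pairForm (δ1 f) (δ1 f')) L μ y b))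
    + (linCountAt ρ L μ y f * cCountAt ρ L μ y f' - linCountAt ρ L μ y f' * cCountAt ρ L μ y f)
    + (L : ℤ) ^ d * wedge (segUp (pairForm (δ1 f) (δ1 f')) ((L : ℤ) • y + ρ) μ L)

/-- [folklore] `m` UNNORMALISED, rooted, product chart (`= 2L^{2d} · m^ρ_b(f, f′)`). -/
def vhCountAt (ρ : Fin d → ℤ) (L : ℕ) (μ : Fin d) (y : Fin d → ℤ) (f f' : Bond d) : ℤ :=
  (L : ℤ) ^ d * hessCountAt ρ L μ y f f' + (L : ℤ) ^ d * (if f = f' then linCountAt ρ L μ y f else 0)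
    - linCountAt ρ L μ y f * linCountAt ρ L μ y f'

variable {𝔸 : Type*} [Ring 𝔸]

/-- [folklore] `linAvgAt ρ (single f w) = linCountAt ρ f • w`. -/
theorem linAvgAt_single (ρ : Fin d → ℤ) (f : Bond d) (w : 𝔸) (L : ℕ) (μ : Fin d) (y : Fin d → ℤ) :
    linAvgAt ρ (single f w) L μ y = linCountAt ρ L μ y f • w := by
  rw [single_eq_mapForm, linAvgAt_mapForm, zmultiplesHom_apply, linCountAt]

/-- [folklore] The rooted coarse-bond segment sum of `single f w` is `cCountAt ρ f • w`. -/
theorem segUp_root_sum_single (ρ : Fin d → ℤ) (f : Bond d) (w : 𝔸) (L : ℕ) (μ : Fin d) (y : Fin d → ℤ) :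
    (segUp (single f w) ((L : ℤ) • y + ρ) μ L).sum = cCountAt ρ L μ y f • w := by
  rw [single_eq_mapForm, ← segUp_map, ← map_list_sum, zmultiplesHom_apply, cCountAt]

/-- [folklore] **IDENTIFICATION (rooted W-Hessian):** `hessUAt ρ (w·δ_f) (w′·δ_{f′}) = hessCountAt ρ f f′ • [w, w′]`. -/
theorem hessUAt_single (ρ : Fin d → ℤ) (f f' : Bond d) (w w' : 𝔸) (L : ℕ) (μ : Fin d) (y : Fin d → ℤ) :
    hessUAt ρ (single f w) (single f' w') L μ y = hessCountAt ρ L μ y f f' • comm w w' := by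
  have h1 : ∀ b, cross (loopCAt ρ (pairForm (single f w) (single f' w')) L μ y b)
      = wedge (loopCAt ρ (pairForm (δ1 f) (δ1 f')) L μ y b) • comm w w' := by
    intro b
    rw [pairForm_single, ← loopCAt_map, cross_map_smulPair]
  have h2 : cross (segUp (pairForm (single f w) (single f' w')) ((L : ℤ) • y + ρ) μ L)
      = wedge (segUp (pairForm (δ1 f) (δ1 f')) ((L : ℤ) • y + ρ) μ L) • comm w w' := by
    rw [pairForm_single, ← segUp_map, cross_map_smulPair]
  simp only [hessUAt, h1, h2, linAvgAt_single, segUp_root_sum_single, comm_zsmul_zsmul, hessCountAt,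
    ← Finset.sum_smul, smul_smul, comm_anticomm w w', smul_neg, add_smul, sub_smul]
  abel

/-- [folklore] **IDENTIFICATION (rooted field–multiplier block):** `vhUAt ρ (w·δ_f) (v·δ_{f′}) = vhCountAt ρ f f′ •
[w, v]`. -/
theorem vhUAt_single (ρ : Fin d → ℤ) (f f' : Bond d) (w v : 𝔸) (L : ℕ) (μ : Fin d) (y : Fin d → ℤ) :
    vhUAt ρ (single f w) (single f' v) L μ y = vhCountAt ρ L μ y f f' • comm w v := by
  rw [vhUAt, hessUAt_single, bw_single, linAvgAt_single, linAvgAt_single, linAvgAt_single, comm_zsmul_zsmul,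
    vhCountAt, smul_smul, sub_smul, add_smul, mul_smul ((L : ℤ) ^ d) (ite _ _ _)]
  congr 2
  split_ifs <;> simp

/-- [folklore] `hessCountAt` is ANTISYMMETRIC. -/
theorem hessCountAt_swap (ρ : Fin d → ℤ) (L : ℕ) (μ : Fin d) (y : Fin d → ℤ) (f f' : Bond d) :
    hessCountAt ρ L μ y f' f = -hessCountAt ρ L μ y f f' := by
  have h1 : ∀ b, wedge (loopCAt ρ (pairForm (δ1 f') (δ1 f)) L μ y b)
      = -wedge (loopCAt ρ (pairForm (δ1 f) (δ1 f')) L μ y b) := by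
    intro b; rw [loopCAt_pairForm_swap ρ (δ1 f) (δ1 f'), wedge_swap]
  have h2 : wedge (segUp (pairForm (δ1 f') (δ1 f)) ((L : ℤ) • y + ρ) μ L)
      = -wedge (segUp (pairForm (δ1 f) (δ1 f')) ((L : ℤ) • y + ρ) μ L) := by
    rw [segUp_pairForm_swap (δ1 f) (δ1 f'), wedge_swap]
  simp only [hessCountAt, h1, h2, Finset.sum_neg_distrib]
  ring

/-- [folklore] `hessCountAt ρ f f = 0`. -/
@[simp] theorem hessCountAt_self (ρ : Fin d → ℤ) (L : ℕ) (μ : Fin d) (y : Fin d → ℤ) (f : Bond d) :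
    hessCountAt ρ L μ y f f = 0 := by
  have := hessCountAt_swap ρ L μ y f f
  omega

end Counts

/-! ## §4 Support (root offset in the box): node 7a's support box `Near L y` still holds every letter -/

section Support

variable {d : ℕ} {R : Type*} [AddCommGroup R]

/-- [folklore] Every letter of `Γ^ρ_{c,x}`, `x ∈ B(y)`, `ρ = toSite r`, `r ∈ box`, is a bond based in the support box. -/
theorem lettersIn_gammaCAt (A : Form1 d R) (L : ℕ) (μ : Fin d) (y : Fin d → ℤ) {r b : Fin d → ℕ}
    (hr : r ∈ box d L) (hb : b ∈ box d L) : LettersIn A (Near L y) (gammaCAt (toSite r) A L μ y b) := by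
  have hr' : ∀ i, r i < L := by simpa [AffineAveraging.box, Fintype.mem_piFinset, Finset.mem_range] using hr
  have hb' : ∀ i, b i < L := by simpa [AffineAveraging.box, Fintype.mem_piFinset, Finset.mem_range] using hb
  refine LettersIn.append (LettersIn.append ?_ ?_) ?_
  · refine (lettersIn_axial A _ _).mono fun x' hx' i => ?_
    obtain ⟨h1, h2⟩ := hx' i
    have hi := hb' i; have hri := hr' i
    simp only [Pi.add_apply, Pi.smul_apply, smul_eq_mul, toSite] at h1 h2
    rw [min_le_iff] at h1; rw [le_max_iff] at h2
    constructor <;> omega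
  · intro a ha
    obtain ⟨s, hs', rfl⟩ := mem_segUp ha
    refine ⟨μ, _, fun i => ?_, Or.inl rfl⟩
    have hi := hb' i
    simp only [Pi.add_apply, Pi.smul_apply, smul_eq_mul, toSite, unitVec_apply]
    split_ifs <;> constructor <;> omega
  · refine (lettersIn_axial A _ _).rev.mono fun x' hx' i => ?_
    obtain ⟨h1, h2⟩ := hx' i
    have hi := hb' i; have hri := hr' i
    simp only [Pi.add_apply, Pi.smul_apply, smul_eq_mul, toSite, unitVec_apply] at h1 h2
    rw [min_le_iff] at h1; rw [le_max_iff] at h2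
    split_ifs at h1 h2 <;> constructor <;> omega

/-- [folklore] Every letter of the straight coarse bond from a root in the box is based in the support box. -/
theorem lettersIn_cSegAt (A : Form1 d R) (L : ℕ) (μ : Fin d) (y : Fin d → ℤ) {r : Fin d → ℕ} (hr : r ∈ box d L) :
    LettersIn A (Near L y) (segUp A ((L : ℤ) • y + toSite r) μ L) := by
  have hr' : ∀ i, r i < L := by simpa [AffineAveraging.box, Fintype.mem_piFinset, Finset.mem_range] using hr
  intro a ha
  obtain ⟨s, hs', rfl⟩ := mem_segUp ha
  refine ⟨μ, _, fun i => ?_, Or.inl rfl⟩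
  have hri := hr' i
  simp only [Pi.add_apply, Pi.smul_apply, smul_eq_mul, toSite, unitVec_apply]
  split_ifs <;> constructor <;> omega

/-- [folklore] Every letter of the rooted closed loop is based in the support box. -/
theorem lettersIn_loopCAt (A : Form1 d R) (L : ℕ) (μ : Fin d) (y : Fin d → ℤ) {r b : Fin d → ℕ}
    (hr : r ∈ box d L) (hb : b ∈ box d L) : LettersIn A (Near L y) (loopCAt (toSite r) A L μ y b) :=
  (lettersIn_gammaCAt A L μ y hr hb).append (lettersIn_cSegAt A L μ y hr).rev

/-! ### FINITE RANGE of the three rooted kernels (root offset in the box) -/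

/-- [folklore] `q¹` vanishes off the support box. -/
theorem linCountAt_eq_zero {L : ℕ} {μ : Fin d} {y : Fin d → ℤ} {r : Fin d → ℕ} (hr : r ∈ box d L) {f : Bond d}
    (h : ¬ Near L y f.2) : linCountAt (toSite r) L μ y f = 0 :=
  Finset.sum_eq_zero fun _ hb => sum_eq_zero_of_lettersIn h (lettersIn_gammaCAt _ L μ y hr hb)

/-- [folklore] `cCountAt` vanishes off the support box. -/
theorem cCountAt_eq_zero {L : ℕ} {μ : Fin d} {y : Fin d → ℤ} {r : Fin d → ℕ} (hr : r ∈ box d L) {f : Bond d}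
    (h : ¬ Near L y f.2) : cCountAt (toSite r) L μ y f = 0 :=
  sum_eq_zero_of_lettersIn h (lettersIn_cSegAt _ L μ y hr)

/-- [folklore] `h` vanishes unless BOTH bonds lie in the support box. -/
theorem hessCountAt_eq_zero_left {L : ℕ} {μ : Fin d} {y : Fin d → ℤ} {r : Fin d → ℕ} (hr : r ∈ box d L)
    {f : Bond d} (h : ¬ Near L y f.2) (f' : Bond d) : hessCountAt (toSite r) L μ y f f' = 0 := by
  have h1 : ∀ b ∈ box d L, wedge (loopCAt (toSite r) (pairForm (δ1 f) (δ1 f')) L μ y b) = 0 := fun b hb =>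
    wedge_eq_zero_of_fst _ (fst_eq_zero_of_lettersIn h (lettersIn_loopCAt _ L μ y hr hb))
  have h2 : wedge (segUp (pairForm (δ1 f) (δ1 f')) ((L : ℤ) • y + toSite r) μ L) = 0 :=
    wedge_eq_zero_of_fst _ (fst_eq_zero_of_lettersIn h (lettersIn_cSegAt _ L μ y hr))
  rw [hessCountAt, Finset.sum_eq_zero h1, h2, linCountAt_eq_zero hr h, cCountAt_eq_zero hr h]
  ring

/-- [folklore] `hessCountAt` vanishes when the second bond is off the support box. -/
theorem hessCountAt_eq_zero_right {L : ℕ} {μ : Fin d} {y : Fin d → ℤ} {r : Fin d → ℕ} (hr : r ∈ box d L)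
    (f : Bond d) {f' : Bond d} (h : ¬ Near L y f'.2) : hessCountAt (toSite r) L μ y f f' = 0 := by
  rw [← neg_neg (hessCountAt (toSite r) L μ y f f'), ← hessCountAt_swap, hessCountAt_eq_zero_left hr h, neg_zero]

/-- [folklore] `m` vanishes unless BOTH bonds lie in the support box. -/
theorem vhCountAt_eq_zero_left {L : ℕ} {μ : Fin d} {y : Fin d → ℤ} {r : Fin d → ℕ} (hr : r ∈ box d L)
    {f : Bond d} (h : ¬ Near L y f.2) (f' : Bond d) : vhCountAt (toSite r) L μ y f f' = 0 := by
  rw [vhCountAt, hessCountAt_eq_zero_left hr h, linCountAt_eq_zero hr h]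
  split_ifs <;> simp

/-- [folklore] `vhCountAt` vanishes when the second bond is off the support box. -/
theorem vhCountAt_eq_zero_right {L : ℕ} {μ : Fin d} {y : Fin d → ℤ} {r : Fin d → ℕ} (hr : r ∈ box d L)
    (f : Bond d) {f' : Bond d} (h : ¬ Near L y f'.2) : vhCountAt (toSite r) L μ y f f' = 0 := by
  rw [vhCountAt, hessCountAt_eq_zero_right hr f h, linCountAt_eq_zero hr h]
  split_ifs with e
  · subst e; rw [linCountAt_eq_zero hr h]; simp
  · simp

end Support

/-! ## §5 Entry bounds (root offset in the box; node 7a's `ell d L = (2d+2)L`) -/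

section Bounds

variable {d : ℕ}

/-- [folklore] `|Γ^ρ_{c,x}| ≤ ℓ`. -/
theorem gammaCAt_length_le_ell {R : Type*} [AddCommGroup R] (A : Form1 d R) {L : ℕ} (hL : 1 ≤ L) (μ : Fin d)
    (y : Fin d → ℤ) {r b : Fin d → ℕ} (hr : r ∈ box d L) (hb : b ∈ box d L) :
    (gammaCAt (toSite r) A L μ y b).length ≤ ell d L := by
  have := gammaCAt_length_le A hL μ y hr hb
  unfold ell; have : (2 * d + 1) * L - 2 * d ≤ (2 * d + 2) * L := by
    have := Nat.sub_le ((2 * d + 1) * L) (2 * d); nlinarith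
  omega

/-- [folklore] `|Γ^ρ_{c,x} ∪ (−c)| ≤ ℓ`. -/
theorem loopCAt_length_le_ell {R : Type*} [AddCommGroup R] (A : Form1 d R) {L : ℕ} (hL : 1 ≤ L) (μ : Fin d)
    (y : Fin d → ℤ) {r b : Fin d → ℕ} (hr : r ∈ box d L) (hb : b ∈ box d L) :
    (loopCAt (toSite r) A L μ y b).length ≤ ell d L := by
  have := loopCAt_length_le A hL μ y hr hb
  unfold ell; have : (2 * d + 2) * L - 2 * d ≤ (2 * d + 2) * L := Nat.sub_le _ _
  omega

/-- [folklore] `|q¹| ≤ L^d · ℓ` (unnormalised, rooted). -/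
theorem abs_linCountAt_le {L : ℕ} (hL : 1 ≤ L) (μ : Fin d) (y : Fin d → ℤ) {r : Fin d → ℕ} (hr : r ∈ box d L)
    (f : Bond d) : |linCountAt (toSite r) L μ y f| ≤ (L : ℤ) ^ d * ell d L := by
  unfold linCountAt linAvgAt
  refine (Finset.abs_sum_le_sum_abs _ _).trans ?_
  have h : ∀ b ∈ box d L, |(gammaCAt (toSite r) (δ1 f) L μ y b).sum| ≤ (ell d L : ℤ) := fun b hb =>
    (abs_sum_le_length _ (abs_le_one_of_lettersIn (lettersIn_gammaCAt _ L μ y hr hb))).trans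
      (by exact_mod_cast gammaCAt_length_le_ell _ hL μ y hr hb)
  refine (Finset.sum_le_card_nsmul _ _ _ h).trans ?_
  have hcard : (box d L).card = L ^ d := by simp [AffineAveraging.box, Fintype.card_piFinset]
  rw [hcard, nsmul_eq_mul]; push_cast; exact le_rfl

/-- [folklore] `|cCountAt| ≤ L`. -/
theorem abs_cCountAt_le (L : ℕ) (μ : Fin d) (y : Fin d → ℤ) {r : Fin d → ℕ} (hr : r ∈ box d L) (f : Bond d) :
    |cCountAt (toSite r) L μ y f| ≤ L := by
  unfold cCountAt
  refine (abs_sum_le_length _ (abs_le_one_of_lettersIn (lettersIn_cSegAt _ L μ y hr))).trans ?_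
  rw [segUp_length]

/-- [folklore] `|h| ≤ 4 L^d ℓ²` (unnormalised, rooted). -/
theorem abs_hessCountAt_le {L : ℕ} (hL : 1 ≤ L) (μ : Fin d) (y : Fin d → ℤ) {r : Fin d → ℕ} (hr : r ∈ box d L)
    (f f' : Bond d) : |hessCountAt (toSite r) L μ y f f'| ≤ 4 * (L : ℤ) ^ d * (ell d L : ℤ) ^ 2 := by
  have hLd : (1 : ℤ) ≤ (L : ℤ) ^ d := by exact_mod_cast Nat.one_le_pow _ _ hL
  have hℓ : (L : ℤ) ≤ ell d L := by exact_mod_cast le_ell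
  have hℓ0 : (0 : ℤ) ≤ L := by positivity
  have h1 : |∑ b ∈ box d L, wedge (loopCAt (toSite r) (pairForm (δ1 f) (δ1 f')) L μ y b)|
      ≤ (L : ℤ) ^ d * (ell d L : ℤ) ^ 2 := by
    refine (Finset.abs_sum_le_sum_abs _ _).trans ?_
    have h : ∀ b ∈ box d L, |wedge (loopCAt (toSite r) (pairForm (δ1 f) (δ1 f')) L μ y b)| ≤ (ell d L : ℤ) ^ 2 :=
      fun b hb => (abs_wedge_le _ (abs_le_one_of_lettersIn_pair (lettersIn_loopCAt _ L μ y hr hb))).trans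
        (pow_le_pow_left₀ (by positivity) (by exact_mod_cast loopCAt_length_le_ell _ hL μ y hr hb) 2)
    refine (Finset.sum_le_card_nsmul _ _ _ h).trans ?_
    have hcard : (box d L).card = L ^ d := by simp [AffineAveraging.box, Fintype.card_piFinset]
    rw [hcard, nsmul_eq_mul]; push_cast; exact le_rfl
  have h2 : |linCountAt (toSite r) L μ y f * cCountAt (toSite r) L μ y f'
      - linCountAt (toSite r) L μ y f' * cCountAt (toSite r) L μ y f| ≤ 2 * ((L : ℤ) ^ d * (ell d L : ℤ) ^ 2) := by
    have ha := abs_linCountAt_le hL μ y hr f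
    have hb := abs_linCountAt_le hL μ y hr f'
    have hc := abs_cCountAt_le L μ y hr f
    have hd := abs_cCountAt_le L μ y hr f'
    have := abs_sub (linCountAt (toSite r) L μ y f * cCountAt (toSite r) L μ y f')
      (linCountAt (toSite r) L μ y f' * cCountAt (toSite r) L μ y f)
    rw [abs_mul, abs_mul] at this
    have e1 : |linCountAt (toSite r) L μ y f| * |cCountAt (toSite r) L μ y f'| ≤ ((L : ℤ) ^ d * ell d L) * ell d L :=
      mul_le_mul ha (hd.trans hℓ) (abs_nonneg _) (by positivity)
    have e2 : |linCountAt (toSite r) L μ y f'| * |cCountAt (toSite r) L μ y f| ≤ ((L : ℤ) ^ d * ell d L) * ell d L :=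
      mul_le_mul hb (hc.trans hℓ) (abs_nonneg _) (by positivity)
    nlinarith
  have h3 : |(L : ℤ) ^ d * wedge (segUp (pairForm (δ1 f) (δ1 f')) ((L : ℤ) • y + toSite r) μ L)|
      ≤ (L : ℤ) ^ d * (ell d L : ℤ) ^ 2 := by
    rw [abs_mul, abs_of_nonneg (by positivity : (0 : ℤ) ≤ (L : ℤ) ^ d)]
    refine mul_le_mul_of_nonneg_left ?_ (by positivity)
    refine (abs_wedge_le _ (abs_le_one_of_lettersIn_pair (lettersIn_cSegAt _ L μ y hr))).trans ?_
    rw [segUp_length]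
    exact pow_le_pow_left₀ hℓ0 hℓ 2
  rw [hessCountAt]
  have := abs_add_three (∑ b ∈ box d L, wedge (loopCAt (toSite r) (pairForm (δ1 f) (δ1 f')) L μ y b))
    (linCountAt (toSite r) L μ y f * cCountAt (toSite r) L μ y f'
      - linCountAt (toSite r) L μ y f' * cCountAt (toSite r) L μ y f)
    ((L : ℤ) ^ d * wedge (segUp (pairForm (δ1 f) (δ1 f')) ((L : ℤ) • y + toSite r) μ L))
  linarith

/-- [folklore] `|m| ≤ 6 L^{2d} ℓ²` (unnormalised, rooted). -/
theorem abs_vhCountAt_le {L : ℕ} (hL : 1 ≤ L) (μ : Fin d) (y : Fin d → ℤ) {r : Fin d → ℕ} (hr : r ∈ box d L)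
    (f f' : Bond d) : |vhCountAt (toSite r) L μ y f f'| ≤ 6 * (L : ℤ) ^ (2 * d) * (ell d L : ℤ) ^ 2 := by
  have hLd : (1 : ℤ) ≤ (L : ℤ) ^ d := by exact_mod_cast Nat.one_le_pow _ _ hL
  have hℓ1 : (1 : ℤ) ≤ ell d L := by have := @le_ell d L; omega
  have hh := abs_hessCountAt_le hL μ y hr f f'
  have ha := abs_linCountAt_le hL μ y hr f
  have hb := abs_linCountAt_le hL μ y hr f'
  have h2d : (L : ℤ) ^ (2 * d) = (L : ℤ) ^ d * (L : ℤ) ^ d := by rw [two_mul, pow_add]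
  have hi : |(if f = f' then linCountAt (toSite r) L μ y f else 0)| ≤ (L : ℤ) ^ d * ell d L := by
    split_ifs
    · exact ha
    · rw [abs_zero]; positivity
  rw [vhCountAt]
  have t1 := abs_sub (↑L ^ d * hessCountAt (toSite r) L μ y f f'
      + ↑L ^ d * (if f = f' then linCountAt (toSite r) L μ y f else 0))
    (linCountAt (toSite r) L μ y f * linCountAt (toSite r) L μ y f')
  have t2 := abs_add_le (↑L ^ d * hessCountAt (toSite r) L μ y f f')
    (↑L ^ d * (if f = f' then linCountAt (toSite r) L μ y f else 0))
  rw [abs_mul, abs_mul, abs_of_nonneg (by positivity : (0 : ℤ) ≤ (L : ℤ) ^ d)] at t2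
  rw [abs_mul] at t1
  have e1 : (L : ℤ) ^ d * |hessCountAt (toSite r) L μ y f f'| ≤ (L : ℤ) ^ d * (4 * (L : ℤ) ^ d * (ell d L : ℤ) ^ 2) :=
    mul_le_mul_of_nonneg_left hh (by positivity)
  have e2 : (L : ℤ) ^ d * |(if f = f' then linCountAt (toSite r) L μ y f else 0)|
      ≤ (L : ℤ) ^ d * ((L : ℤ) ^ d * ell d L) := mul_le_mul_of_nonneg_left hi (by positivity)
  have e3 : |linCountAt (toSite r) L μ y f| * |linCountAt (toSite r) L μ y f'|
      ≤ ((L : ℤ) ^ d * ell d L) * ((L : ℤ) ^ d * ell d L) := mul_le_mul ha hb (abs_nonneg _) (by positivity)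
  have e4 : (L : ℤ) ^ d * ((L : ℤ) ^ d * (ell d L : ℤ)) ≤ (L : ℤ) ^ d * ((L : ℤ) ^ d * (ell d L : ℤ) ^ 2) := by
    refine mul_le_mul_of_nonneg_left (mul_le_mul_of_nonneg_left ?_ (by positivity)) (by positivity)
    nlinarith
  rw [h2d]
  nlinarith

end Bounds

/-! ## §6 Block-translation covariance (coarse index `y ↦ y + t`, bonds shifted by `L·t`, root offset FIXED) -/

section Covariance

variable {d : ℕ}

/-- [folklore] BLOCK COVARIANCE of the rooted `q¹`. -/
theorem linCountAt_add (ρ : Fin d → ℤ) (L : ℕ) (μ : Fin d) (y t : Fin d → ℤ) (f : Bond d) :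
    linCountAt ρ L μ (y + t) (f.sh ((L : ℤ) • t)) = linCountAt ρ L μ y f := by
  rw [linCountAt, linAvgAt_add, shift_δ1, linCountAt]

/-- [folklore] Block-translation covariance of the rooted `cCount`. -/
theorem cCountAt_add (ρ : Fin d → ℤ) (L : ℕ) (μ : Fin d) (y t : Fin d → ℤ) (f : Bond d) :
    cCountAt ρ L μ (y + t) (f.sh ((L : ℤ) • t)) = cCountAt ρ L μ y f := by
  have e : (L : ℤ) • (y + t) + ρ = ((L : ℤ) • y + ρ) + (L : ℤ) • t := by rw [smul_add]; abel
  rw [cCountAt, e, segUp_add, shift_δ1, cCountAt]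

/-- [folklore] BLOCK COVARIANCE of the rooted `h`. -/
theorem hessCountAt_add (ρ : Fin d → ℤ) (L : ℕ) (μ : Fin d) (y t : Fin d → ℤ) (f f' : Bond d) :
    hessCountAt ρ L μ (y + t) (f.sh ((L : ℤ) • t)) (f'.sh ((L : ℤ) • t)) = hessCountAt ρ L μ y f f' := by
  have e : (L : ℤ) • (y + t) + ρ = ((L : ℤ) • y + ρ) + (L : ℤ) • t := by rw [smul_add]; abel
  simp only [hessCountAt, loopCAt_add, e, segUp_add, shift_pairForm, shift_δ1, linCountAt_add, cCountAt_add]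

/-- [folklore] BLOCK COVARIANCE of the rooted `m`. -/
theorem vhCountAt_add (ρ : Fin d → ℤ) (L : ℕ) (μ : Fin d) (y t : Fin d → ℤ) (f f' : Bond d) :
    vhCountAt ρ L μ (y + t) (f.sh ((L : ℤ) • t)) (f'.sh ((L : ℤ) • t)) = vhCountAt ρ L μ y f f' := by
  simp only [vhCountAt, hessCountAt_add, linCountAt_add, Bond.sh_inj]

end Covariance

/-! ## §7 The rooted real kernels `q¹ = linCountAt/L^d`, `h = hessCountAt/(2L^d)`, `m = vhCountAt/(2L^{2d})` -/

section RealKernels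

variable {d : ℕ}

/-- [folklore] `q¹,ρ_b(f)`. -/
noncomputable def linKerAt (ρ : Fin d → ℤ) (L : ℕ) (μ : Fin d) (y : Fin d → ℤ) (f : Bond d) : ℝ :=
  (linCountAt ρ L μ y f : ℝ) / (L : ℝ) ^ d

/-- [folklore] `h^ρ_b(f, f′)`. -/
noncomputable def hessKerAt (ρ : Fin d → ℤ) (L : ℕ) (μ : Fin d) (y : Fin d → ℤ) (f f' : Bond d) : ℝ :=
  (hessCountAt ρ L μ y f f' : ℝ) / (2 * (L : ℝ) ^ d)

/-- [folklore] `m^ρ_b(f, f′)` (product chart). -/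
noncomputable def vhKerAt (ρ : Fin d → ℤ) (L : ℕ) (μ : Fin d) (y : Fin d → ℤ) (f f' : Bond d) : ℝ :=
  (vhCountAt ρ L μ y f f' : ℝ) / (2 * (L : ℝ) ^ (2 * d))

/-- [folklore] ANTISYMMETRY of `hessKerAt`. -/
theorem hessKerAt_swap (ρ : Fin d → ℤ) (L : ℕ) (μ : Fin d) (y : Fin d → ℤ) (f f' : Bond d) :
    hessKerAt ρ L μ y f' f = -hessKerAt ρ L μ y f f' := by
  rw [hessKerAt, hessKerAt, hessCountAt_swap, Int.cast_neg, neg_div]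

/-- [folklore] `hessKerAt` vanishes when the first bond is off the support box (box root). -/
theorem hessKerAt_eq_zero_left {L : ℕ} {μ : Fin d} {y : Fin d → ℤ} {r : Fin d → ℕ} (hr : r ∈ box d L)
    {f : Bond d} (h : ¬ Near L y f.2) (f' : Bond d) : hessKerAt (toSite r) L μ y f f' = 0 := by
  rw [hessKerAt, hessCountAt_eq_zero_left hr h, Int.cast_zero, zero_div]

/-- [folklore] `hessKerAt` vanishes when the second bond is off the support box (box root). -/
theorem hessKerAt_eq_zero_right {L : ℕ} {μ : Fin d} {y : Fin d → ℤ} {r : Fin d → ℕ} (hr : r ∈ box d L)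
    (f : Bond d) {f' : Bond d} (h : ¬ Near L y f'.2) : hessKerAt (toSite r) L μ y f f' = 0 := by
  rw [hessKerAt, hessCountAt_eq_zero_right hr f h, Int.cast_zero, zero_div]

/-- [folklore] `vhKerAt` vanishes when the first bond is off the support box (box root). -/
theorem vhKerAt_eq_zero_left {L : ℕ} {μ : Fin d} {y : Fin d → ℤ} {r : Fin d → ℕ} (hr : r ∈ box d L)
    {f : Bond d} (h : ¬ Near L y f.2) (f' : Bond d) : vhKerAt (toSite r) L μ y f f' = 0 := by
  rw [vhKerAt, vhCountAt_eq_zero_left hr h, Int.cast_zero, zero_div]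

/-- [folklore] `vhKerAt` vanishes when the second bond is off the support box (box root). -/
theorem vhKerAt_eq_zero_right {L : ℕ} {μ : Fin d} {y : Fin d → ℤ} {r : Fin d → ℕ} (hr : r ∈ box d L)
    (f : Bond d) {f' : Bond d} (h : ¬ Near L y f'.2) : vhKerAt (toSite r) L μ y f f' = 0 := by
  rw [vhKerAt, vhCountAt_eq_zero_right hr f h, Int.cast_zero, zero_div]

/-- [folklore] `linKerAt` vanishes off the support box (box root). -/
theorem linKerAt_eq_zero {L : ℕ} {μ : Fin d} {y : Fin d → ℤ} {r : Fin d → ℕ} (hr : r ∈ box d L) {f : Bond d}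
    (h : ¬ Near L y f.2) : linKerAt (toSite r) L μ y f = 0 := by
  rw [linKerAt, linCountAt_eq_zero hr h, Int.cast_zero, zero_div]

/-- [folklore] Block-translation covariance of `hessKerAt`. -/
theorem hessKerAt_add (ρ : Fin d → ℤ) (L : ℕ) (μ : Fin d) (y t : Fin d → ℤ) (f f' : Bond d) :
    hessKerAt ρ L μ (y + t) (f.sh ((L : ℤ) • t)) (f'.sh ((L : ℤ) • t)) = hessKerAt ρ L μ y f f' := by
  rw [hessKerAt, hessKerAt, hessCountAt_add]

/-- [folklore] Block-translation covariance of `vhKerAt`. -/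
theorem vhKerAt_add (ρ : Fin d → ℤ) (L : ℕ) (μ : Fin d) (y t : Fin d → ℤ) (f f' : Bond d) :
    vhKerAt ρ L μ (y + t) (f.sh ((L : ℤ) • t)) (f'.sh ((L : ℤ) • t)) = vhKerAt ρ L μ y f f' := by
  rw [vhKerAt, vhKerAt, vhCountAt_add]

/-- [folklore] Block-translation covariance of `linKerAt`. -/
theorem linKerAt_add (ρ : Fin d → ℤ) (L : ℕ) (μ : Fin d) (y t : Fin d → ℤ) (f : Bond d) :
    linKerAt ρ L μ (y + t) (f.sh ((L : ℤ) • t)) = linKerAt ρ L μ y f := by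
  rw [linKerAt, linKerAt, linCountAt_add]

/-- [folklore] `|h^ρ| ≤ 2ℓ²` (box root). -/
theorem abs_hessKerAt_le {L : ℕ} (hL : 1 ≤ L) (μ : Fin d) (y : Fin d → ℤ) {r : Fin d → ℕ} (hr : r ∈ box d L)
    (f f' : Bond d) : |hessKerAt (toSite r) L μ y f f'| ≤ 2 * (ell d L : ℝ) ^ 2 := by
  have hLd : (0 : ℝ) < (L : ℝ) ^ d := by positivity
  have h := abs_hessCountAt_le hL μ y hr f f'
  have h' : (|hessCountAt (toSite r) L μ y f f'| : ℝ) ≤ 4 * (L : ℝ) ^ d * (ell d L : ℝ) ^ 2 := by exact_mod_cast h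
  rw [hessKerAt, abs_div, abs_of_pos (by positivity : (0 : ℝ) < 2 * (L : ℝ) ^ d), div_le_iff₀ (by positivity)]
  nlinarith

/-- [folklore] `|m^ρ| ≤ 3ℓ²` (box root). -/
theorem abs_vhKerAt_le {L : ℕ} (hL : 1 ≤ L) (μ : Fin d) (y : Fin d → ℤ) {r : Fin d → ℕ} (hr : r ∈ box d L)
    (f f' : Bond d) : |vhKerAt (toSite r) L μ y f f'| ≤ 3 * (ell d L : ℝ) ^ 2 := by
  have hLd : (0 : ℝ) < (L : ℝ) ^ (2 * d) := by positivity
  have h := abs_vhCountAt_le hL μ y hr f f'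
  have h' : (|vhCountAt (toSite r) L μ y f f'| : ℝ) ≤ 6 * (L : ℝ) ^ (2 * d) * (ell d L : ℝ) ^ 2 := by
    exact_mod_cast h
  rw [vhKerAt, abs_div, abs_of_pos (by positivity : (0 : ℝ) < 2 * (L : ℝ) ^ (2 * d)), div_le_iff₀ (by positivity)]
  nlinarith

/-- [folklore] `|q¹,ρ| ≤ ℓ` (box root). -/
theorem abs_linKerAt_le {L : ℕ} (hL : 1 ≤ L) (μ : Fin d) (y : Fin d → ℤ) {r : Fin d → ℕ} (hr : r ∈ box d L)
    (f : Bond d) : |linKerAt (toSite r) L μ y f| ≤ (ell d L : ℝ) := by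
  have hLd : (0 : ℝ) < (L : ℝ) ^ d := by positivity
  have h := abs_linCountAt_le hL μ y hr f
  have h' : (|linCountAt (toSite r) L μ y f| : ℝ) ≤ (L : ℝ) ^ d * (ell d L : ℝ) := by exact_mod_cast h
  rw [linKerAt, abs_div, abs_of_pos hLd, div_le_iff₀ hLd]
  nlinarith

end RealKernels

/-! ## §8 Packing with node 7a's `packVH`: the rooted stencil families `vhSAt`, `vhSaddAt`, `hessFFAt` -/

section Packing

variable {d : ℕ}

open ExpKernelCalculus (MKer BiLoc shiftK)
open OneStepResolventKernel (Fib LocStencil)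
open B12Sec2to5 (l1 l1_nonneg)

/-- [folklore] **(b1ρ) THE ROOTED FIELD–MULTIPLIER STENCIL FAMILY, PRODUCT CHART:** node 7a's packer applied to
`m^ρ = vhKerAt ρ` — same slots as `vhS` (`(x, inl α), (z, inr μ) ↦ m^ρ_{(μ, z/L)}((α, x), (κ′, u))`, `z ∈ L·ℤ^{d+1}`). -/
noncomputable def vhSAt (ρ : Fin (d + 1) → ℤ) (d' L : ℕ) (_h : d' = d := by rfl) :
    Fin (d + 1) → (Fin (d + 1) → ℤ) → MKer (d + 1) (Fib d) :=
  packVH (fun μ y f f' => vhKerAt ρ L μ y f f') L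

/-- [folklore] **(b1′ρ) THE ROOTED FIELD–MULTIPLIER STENCIL FAMILY, ADDITIVE CHART:** the packing of `h^ρ = hessKerAt ρ`. -/
noncomputable def vhSaddAt (ρ : Fin (d + 1) → ℤ) (d' L : ℕ) (_h : d' = d := by rfl) :
    Fin (d + 1) → (Fin (d + 1) → ℤ) → MKer (d + 1) (Fib d) :=
  packVH (fun μ y f f' => hessKerAt ρ L μ y f f') L

/-- [folklore] `vhSAt` is symmetric. -/
theorem vhSAt_symm (ρ : Fin (d + 1) → ℤ) (L : ℕ) (κ' : Fin (d + 1)) (u x z : Fin (d + 1) → ℤ) (a b : Fib d) :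
    vhSAt ρ d L rfl κ' u x z a b = vhSAt ρ d L rfl κ' u z x b a := packVH_symm _ L κ' u x z a b

/-- [folklore] `vhSaddAt` is symmetric. -/
theorem vhSaddAt_symm (ρ : Fin (d + 1) → ℤ) (L : ℕ) (κ' : Fin (d + 1)) (u x z : Fin (d + 1) → ℤ) (a b : Fib d) :
    vhSaddAt ρ d L rfl κ' u x z a b = vhSaddAt ρ d L rfl κ' u z x b a := packVH_symm _ L κ' u x z a b

/-- [folklore] **`vhSAt` IS A LOCAL STENCIL FAMILY** (box root) for every `δ ≥ 0`, node 7a's constant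
`3ℓ² · e^{4(d+1)Lδ}`, `ℓ = (2d+4)L`. -/
theorem locStencil_vhSAt {L : ℕ} (hL : 1 ≤ L) {r : Fin (d + 1) → ℕ} (hr : r ∈ box (d + 1) L) {δ : ℝ} (hδ : 0 ≤ δ) :
    LocStencil (vhSAt (toSite r) d L) (3 * (ell (d + 1) L : ℝ) ^ 2 * Real.exp (4 * ((d : ℝ) + 1) * L * δ)) δ :=
  locStencil_packVH _ hL (by positivity) (fun _ _ _ f' h => vhKerAt_eq_zero_left hr h f')
    (fun _ _ f _ h => vhKerAt_eq_zero_right hr f h) (fun μ y f f' => abs_vhKerAt_le hL μ y hr f f') hδ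

/-- [folklore] **`vhSaddAt` IS A LOCAL STENCIL FAMILY** (box root) for every `δ ≥ 0`, constant `2ℓ² · e^{4(d+1)Lδ}`. -/
theorem locStencil_vhSaddAt {L : ℕ} (hL : 1 ≤ L) {r : Fin (d + 1) → ℕ} (hr : r ∈ box (d + 1) L) {δ : ℝ}
    (hδ : 0 ≤ δ) :
    LocStencil (vhSaddAt (toSite r) d L) (2 * (ell (d + 1) L : ℝ) ^ 2 * Real.exp (4 * ((d : ℝ) + 1) * L * δ)) δ :=
  locStencil_packVH _ hL (by positivity) (fun _ _ _ f' h => hessKerAt_eq_zero_left hr h f')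
    (fun _ _ f _ h => hessKerAt_eq_zero_right hr f h) (fun μ y f f' => abs_hessKerAt_le hL μ y hr f f') hδ

/-- [folklore] Block-translation covariance of `vhSAt` (all root offsets). -/
theorem vhSAt_translate (ρ : Fin (d + 1) → ℤ) {L : ℕ} (hL : 1 ≤ L) (κ' : Fin (d + 1)) (u t : Fin (d + 1) → ℤ) :
    vhSAt ρ d L rfl κ' (u + (L : ℤ) • t) = shiftK (-((L : ℤ) • t)) (vhSAt ρ d L rfl κ' u) :=
  packVH_translate _ hL (fun μ y t f f' => vhKerAt_add ρ L μ y t f f') κ' u t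

/-- [folklore] Block-translation covariance of `vhSaddAt` (all root offsets). -/
theorem vhSaddAt_translate (ρ : Fin (d + 1) → ℤ) {L : ℕ} (hL : 1 ≤ L) (κ' : Fin (d + 1)) (u t : Fin (d + 1) → ℤ) :
    vhSaddAt ρ d L rfl κ' (u + (L : ℤ) • t) = shiftK (-((L : ℤ) • t)) (vhSaddAt ρ d L rfl κ' u) :=
  packVH_translate _ hL (fun μ y t f f' => hessKerAt_add ρ L μ y t f f') κ' u t

/-! ### (b2ρ) The rooted W-Hessian of the constraint per coarse bond, packed on the `(inl, inl)` block -/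

/-- [folklore] **(b2ρ) THE ROOTED W-HESSIAN KERNEL OF THE COARSE BOND `b = (μ, y)`** as an `MKer (d+1) (Fib d)` supported
on the field–field block: entry `((x, inl α), (x′, inl α′)) ↦ h^ρ_b((α, x), (α′, x′)) = hessKerAt ρ L μ y (α, x) (α′, x′)`. -/
noncomputable def hessFFAt (ρ : Fin (d + 1) → ℤ) (L : ℕ) (μ : Fin (d + 1)) (y : Fin (d + 1) → ℤ) :
    MKer (d + 1) (Fib d) := fun x x' a b =>
  match a, b with
  | Sum.inl α, Sum.inl α' => hessKerAt ρ L μ y (α, x) (α', x')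
  | _, _ => 0

/-- [folklore] The field–field entries of `hessFFAt`. -/
@[simp] theorem hessFFAt_inl_inl (ρ : Fin (d + 1) → ℤ) (L : ℕ) (μ : Fin (d + 1)) (y x x' : Fin (d + 1) → ℤ)
    (α α' : Fin (d + 1)) : hessFFAt ρ L μ y x x' (Sum.inl α) (Sum.inl α') = hessKerAt ρ L μ y (α, x) (α', x') := rfl

/-- [folklore] `hessFFAt` vanishes on `(inl, inr)`. -/
@[simp] theorem hessFFAt_inl_inr (ρ : Fin (d + 1) → ℤ) (L : ℕ) (μ : Fin (d + 1)) (y x x' : Fin (d + 1) → ℤ)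
    (α μ' : Fin (d + 1)) : hessFFAt ρ L μ y x x' (Sum.inl α) (Sum.inr μ') = 0 := rfl

/-- [folklore] `hessFFAt` vanishes on `(inr, ·)`. -/
@[simp] theorem hessFFAt_inr (ρ : Fin (d + 1) → ℤ) (L : ℕ) (μ : Fin (d + 1)) (y x x' : Fin (d + 1) → ℤ)
    (μ' : Fin (d + 1)) (b : Fib d) : hessFFAt ρ L μ y x x' (Sum.inr μ') b = 0 := by cases b <;> rfl

/-- [folklore] `hessFFAt` is ANTISYMMETRIC (the coefficient of a commutator). -/
theorem hessFFAt_antisymm (ρ : Fin (d + 1) → ℤ) (L : ℕ) (μ : Fin (d + 1)) (y x x' : Fin (d + 1) → ℤ) (a b : Fib d) :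
    hessFFAt ρ L μ y x' x b a = -hessFFAt ρ L μ y x x' a b := by
  rcases a with α | ν <;> rcases b with α' | ν'
  · rw [hessFFAt_inl_inl, hessFFAt_inl_inl, hessKerAt_swap]
  all_goals simp

/-- [folklore] A point of the root's block (`L·y + toSite r`, `r ∈ box`) lies in the support box. -/
theorem near_root {L : ℕ} (hL : 1 ≤ L) (y : Fin (d + 1) → ℤ) {r : Fin (d + 1) → ℕ} (hr : r ∈ box (d + 1) L) :
    Near L y ((L : ℤ) • y + toSite r) := fun i => by
  have hr' : ∀ i, r i < L := by simpa [AffineAveraging.box, Fintype.mem_piFinset, Finset.mem_range] using hr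
  have hri := hr' i
  simp only [Pi.add_apply, Pi.smul_apply, smul_eq_mul, toSite]; constructor <;> omega

/-- [folklore] **`hessFFAt` IS BI-LOCALISED** (box root) at any CENTRE `c` of the support box, for every `δ ≥ 0`, with node
7a's constant `2ℓ² · e^{4(d+1)Lδ}` — the common proof of the two centrings below. -/
theorem biLoc_hessFFAt_of_near {L : ℕ} (hL : 1 ≤ L) (μ : Fin (d + 1)) (y : Fin (d + 1) → ℤ) {r : Fin (d + 1) → ℕ}
    (hr : r ∈ box (d + 1) L) {c : Fin (d + 1) → ℤ} (hc : Near L y c) {δ : ℝ} (hδ : 0 ≤ δ) :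
    BiLoc (hessFFAt (toSite r) L μ y) c c (2 * (ell (d + 1) L : ℝ) ^ 2 * Real.exp (4 * ((d : ℝ) + 1) * L * δ)) δ := by
  intro x x' a b
  have hpos : 0 ≤ 2 * (ell (d + 1) L : ℝ) ^ 2 * Real.exp (4 * ((d : ℝ) + 1) * L * δ) *
      Real.exp (-δ * (l1 (x - c) + l1 (x' - c))) := by positivity
  rcases a with α | ν
  · rcases b with α' | ν'
    · rw [hessFFAt_inl_inl]
      by_cases hx : Near L y x
      · by_cases hx' : Near L y x'
        · have d1 := l1_le_of_near hx hc
          have d2 := l1_le_of_near hx' hc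
          have hsum : δ * (l1 (x - c) + l1 (x' - c)) ≤ 4 * ((d : ℝ) + 1) * L * δ := by nlinarith
          have h1 : 1 ≤ Real.exp (4 * ((d : ℝ) + 1) * L * δ) * Real.exp (-δ * (l1 (x - c) + l1 (x' - c))) := by
            rw [← Real.exp_add]; exact Real.one_le_exp (by linarith)
          have hb := abs_hessKerAt_le hL μ y hr (α, x) (α', x')
          calc |hessKerAt (toSite r) L μ y (α, x) (α', x')| ≤ 2 * (ell (d + 1) L : ℝ) ^ 2 * 1 := by
                rw [mul_one]; exact hb
            _ ≤ 2 * (ell (d + 1) L : ℝ) ^ 2 * (Real.exp (4 * ((d : ℝ) + 1) * L * δ) *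
                  Real.exp (-δ * (l1 (x - c) + l1 (x' - c)))) := mul_le_mul_of_nonneg_left h1 (by positivity)
            _ = _ := by ring
        · rw [hessKerAt_eq_zero_right hr _ hx', abs_zero]; exact hpos
      · rw [hessKerAt_eq_zero_left hr hx, abs_zero]; exact hpos
    · rw [hessFFAt_inl_inr, abs_zero]; exact hpos
  · rw [hessFFAt_inr, abs_zero]; exact hpos

/-- [folklore] **`hessFFAt` IS BI-LOCALISED AT THE COARSE BOND** (at the coarse site's fine image `L·y`, node 7a's byte
shape) for a box root and every `δ ≥ 0`. -/
theorem biLoc_hessFFAt {L : ℕ} (hL : 1 ≤ L) (μ : Fin (d + 1)) (y : Fin (d + 1) → ℤ) {r : Fin (d + 1) → ℕ}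
    (hr : r ∈ box (d + 1) L) {δ : ℝ} (hδ : 0 ≤ δ) :
    BiLoc (hessFFAt (toSite r) L μ y) ((L : ℤ) • y) ((L : ℤ) • y)
      (2 * (ell (d + 1) L : ℝ) ^ 2 * Real.exp (4 * ((d : ℝ) + 1) * L * δ)) δ :=
  biLoc_hessFFAt_of_near hL μ y hr (near_self hL y) hδ

/-- [folklore] **`hessFFAt` IS BI-LOCALISED AT THE FINE ROOT `L·y + ρ`** (box root) for every `δ ≥ 0`, same constant. -/
theorem biLoc_hessFFAt_root {L : ℕ} (hL : 1 ≤ L) (μ : Fin (d + 1)) (y : Fin (d + 1) → ℤ) {r : Fin (d + 1) → ℕ}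
    (hr : r ∈ box (d + 1) L) {δ : ℝ} (hδ : 0 ≤ δ) :
    BiLoc (hessFFAt (toSite r) L μ y) ((L : ℤ) • y + toSite r) ((L : ℤ) • y + toSite r)
      (2 * (ell (d + 1) L : ℝ) ^ 2 * Real.exp (4 * ((d : ℝ) + 1) * L * δ)) δ :=
  biLoc_hessFFAt_of_near hL μ y hr (near_root hL y hr) hδ

/-- [folklore] Block-translation covariance of `hessFFAt` (all root offsets; node 7a's byte shape). -/
theorem hessFFAt_translate (ρ : Fin (d + 1) → ℤ) {L : ℕ} (μ : Fin (d + 1)) (y t : Fin (d + 1) → ℤ) :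
    hessFFAt ρ L μ (y + t) = shiftK (-((L : ℤ) • t)) (hessFFAt ρ L μ y) := by
  funext x x' a b
  simp only [shiftK]
  rcases a with α | ν
  · rcases b with α' | ν'
    · rw [hessFFAt_inl_inl, hessFFAt_inl_inl]
      have := hessKerAt_add ρ L μ y t (α, x + -((L : ℤ) • t)) (α', x' + -((L : ℤ) • t))
      rw [← this]
      congr 1 <;> simp [Bond.sh]
    · rfl
  · cases b <;> rfl

end Packing

/-! ## §9 Bridges `…At 0 = node 7a` (the base-corner root of node 5 / node 7a is the instance `ρ = 0`) -/

section Bridges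

variable {d : ℕ}

section Ring
variable {𝔸 : Type*} [Ring 𝔸]

/-- [folklore] `hessUAt 0 = hessU` (node 7a). -/
@[simp] theorem hessUAt_zero (W W' : Form1 d 𝔸) (L : ℕ) (μ : Fin d) (y : Fin d → ℤ) :
    hessUAt 0 W W' L μ y = hessU W W' L μ y := by
  simp only [hessUAt, hessU, loopCAt_zero, linAvgAt_zero, add_zero]

/-- [folklore] `vhUAt 0 = vhU` (node 7a). -/
@[simp] theorem vhUAt_zero (W B : Form1 d 𝔸) (L : ℕ) (μ : Fin d) (y : Fin d → ℤ) :
    vhUAt 0 W B L μ y = vhU W B L μ y := by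
  simp only [vhUAt, vhU, hessUAt_zero, linAvgAt_zero]

end Ring

/-- [folklore] `linCountAt 0 = linCount` (node 7a). -/
@[simp] theorem linCountAt_zero (L : ℕ) (μ : Fin d) (y : Fin d → ℤ) (f : Bond d) :
    linCountAt 0 L μ y f = linCount L μ y f := by
  rw [linCountAt, linAvgAt_zero, linCount]

/-- [folklore] `cCountAt 0 = cCount` (node 7a). -/
@[simp] theorem cCountAt_zero (L : ℕ) (μ : Fin d) (y : Fin d → ℤ) (f : Bond d) :
    cCountAt 0 L μ y f = cCount L μ y f := by
  rw [cCountAt, add_zero, cCount]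

/-- [folklore] `hessCountAt 0 = hessCount` (node 7a). -/
@[simp] theorem hessCountAt_zero (L : ℕ) (μ : Fin d) (y : Fin d → ℤ) (f f' : Bond d) :
    hessCountAt 0 L μ y f f' = hessCount L μ y f f' := by
  simp only [hessCountAt, hessCount, loopCAt_zero, linCountAt_zero, cCountAt_zero, add_zero]

/-- [folklore] `vhCountAt 0 = vhCount` (node 7a). -/
@[simp] theorem vhCountAt_zero (L : ℕ) (μ : Fin d) (y : Fin d → ℤ) (f f' : Bond d) :
    vhCountAt 0 L μ y f f' = vhCount L μ y f f' := by
  simp only [vhCountAt, vhCount, hessCountAt_zero, linCountAt_zero]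

/-- [folklore] `linKerAt 0 = linKer` (node 7a). -/
@[simp] theorem linKerAt_zero (L : ℕ) (μ : Fin d) (y : Fin d → ℤ) (f : Bond d) :
    linKerAt 0 L μ y f = linKer L μ y f := by
  rw [linKerAt, linCountAt_zero, linKer]

/-- [folklore] `hessKerAt 0 = hessKer` (node 7a). -/
@[simp] theorem hessKerAt_zero (L : ℕ) (μ : Fin d) (y : Fin d → ℤ) (f f' : Bond d) :
    hessKerAt 0 L μ y f f' = hessKer L μ y f f' := by
  rw [hessKerAt, hessCountAt_zero, hessKer]

/-- [folklore] `vhKerAt 0 = vhKer` (node 7a). -/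
@[simp] theorem vhKerAt_zero (L : ℕ) (μ : Fin d) (y : Fin d → ℤ) (f f' : Bond d) :
    vhKerAt 0 L μ y f f' = vhKer L μ y f f' := by
  rw [vhKerAt, vhCountAt_zero, vhKer]

open ExpKernelCalculus (MKer)
open OneStepResolventKernel (Fib)

/-- [folklore] `vhSAt 0 = vhS` (node 7a). -/
@[simp] theorem vhSAt_zero (L : ℕ) : vhSAt (0 : Fin (d + 1) → ℤ) d L rfl = vhS d L := by
  unfold vhSAt vhS; simp only [vhKerAt_zero]

/-- [folklore] `vhSaddAt 0 = vhSadd` (node 7a). -/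
@[simp] theorem vhSaddAt_zero (L : ℕ) : vhSaddAt (0 : Fin (d + 1) → ℤ) d L rfl = vhSadd d L := by
  unfold vhSaddAt vhSadd; simp only [hessKerAt_zero]

/-- [folklore] `hessFFAt 0 = hessFF` (node 7a). -/
@[simp] theorem hessFFAt_zero (L : ℕ) (μ : Fin (d + 1)) (y : Fin (d + 1) → ℤ) :
    hessFFAt (0 : Fin (d + 1) → ℤ) L μ y = hessFF L μ y := by
  funext x x' a b
  rcases a with α | ν <;> rcases b with α' | ν'
  · rw [hessFFAt_inl_inl, hessFF_inl_inl, hessKerAt_zero]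
  all_goals simp

end Bridges

/-! ## §10 Decided toy tables (`d = 1`, `y = 0`, `L = 3`; bonds `c_s = (0, s)`; CENTRED ROOT `ρ = 1` vs node 7a's CORNER ROOT)

* `linCountAt 1 = (0, 3, 3, 3, 0, …)` on `c₀, …, c₄` (the rooted contours run from the fine root `1` to `1 + L = 4`): `q¹ = 1`
  on the three bonds `c₁, c₂, c₃`, versus node 7a's `linCount = (3, 3, 3, 0, …)` (`q¹ = 1` on `c₀, c₁, c₂`) — the two
  differ by the coarse exact form of node 5ρ `linAvgAt_eq_linAvg_add`; `cCountAt 1 = (0, 1, 1, 1, 0)`;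
* `hessCountAt 1 (c_s, c_{s′}) = 3` for `1 ≤ s < s′ ≤ 3` (`h = 3/(2·3) = ½`, the value node 7a's table shows for `L = 2`),
  `= 0` as soon as one bond is `c₀` (outside the rooted words), antisymmetric; node 7a's corner table at `L = 3` is the
  SAME table on `c₀, c₁, c₂` — in `d = 1` re-rooting by `ρ = 1` translates the second-order table by one bond (in `d ≥ 2`
  it does not: the blocks do not move with the root);
* `vhCountAt 1 (c₂, c₁) = vhCountAt 1 (c₃, c₁) = −18` (`m = −18/(2·9) = −1`: the fluctuation on a LATER bond of the rooted
  line sees the background on an EARLIER one, node 7a's sign/slot convention), `vhCountAt 1 (c₁, c₂) = vhCountAt 1 (c₁, c₁)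
  = 0`; node 7a: `vhCount (c₁, c₀) = −18`, `vhCount (c₀, c₀) = 0`. -/

section Toy

example : linCountAt (fun _ => 1) 3 (0 : Fin 1) (fun _ => 0) (0, fun _ => 0) = 0 := by decide
example : linCountAt (fun _ => 1) 3 (0 : Fin 1) (fun _ => 0) (0, fun _ => 1) = 3 := by decide
example : linCountAt (fun _ => 1) 3 (0 : Fin 1) (fun _ => 0) (0, fun _ => 2) = 3 := by decide
example : linCountAt (fun _ => 1) 3 (0 : Fin 1) (fun _ => 0) (0, fun _ => 3) = 3 := by decide
example : linCountAt (fun _ => 1) 3 (0 : Fin 1) (fun _ => 0) (0, fun _ => 4) = 0 := by decide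
example : linCount 3 (0 : Fin 1) (fun _ => 0) (0, fun _ => 0) = 3 := by decide
example : linCount 3 (0 : Fin 1) (fun _ => 0) (0, fun _ => 3) = 0 := by decide
example : cCountAt (fun _ => 1) 3 (0 : Fin 1) (fun _ => 0) (0, fun _ => 0) = 0 := by decide
example : cCountAt (fun _ => 1) 3 (0 : Fin 1) (fun _ => 0) (0, fun _ => 1) = 1 := by decide
example : cCountAt (fun _ => 1) 3 (0 : Fin 1) (fun _ => 0) (0, fun _ => 3) = 1 := by decide
example : cCountAt (fun _ => 1) 3 (0 : Fin 1) (fun _ => 0) (0, fun _ => 4) = 0 := by decide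

example : hessCountAt (fun _ => 1) 3 (0 : Fin 1) (fun _ => 0) (0, fun _ => 1) (0, fun _ => 2) = 3 := by decide
example : hessCountAt (fun _ => 1) 3 (0 : Fin 1) (fun _ => 0) (0, fun _ => 2) (0, fun _ => 1) = -3 := by decide
example : hessCountAt (fun _ => 1) 3 (0 : Fin 1) (fun _ => 0) (0, fun _ => 1) (0, fun _ => 3) = 3 := by decide
example : hessCountAt (fun _ => 1) 3 (0 : Fin 1) (fun _ => 0) (0, fun _ => 2) (0, fun _ => 3) = 3 := by decide
example : hessCountAt (fun _ => 1) 3 (0 : Fin 1) (fun _ => 0) (0, fun _ => 0) (0, fun _ => 1) = 0 := by decide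
example : hessCount 3 (0 : Fin 1) (fun _ => 0) (0, fun _ => 0) (0, fun _ => 1) = 3 := by decide
example : hessCount 3 (0 : Fin 1) (fun _ => 0) (0, fun _ => 0) (0, fun _ => 2) = 3 := by decide
example : hessCount 3 (0 : Fin 1) (fun _ => 0) (0, fun _ => 1) (0, fun _ => 2) = 3 := by decide

example : vhCountAt (fun _ => 1) 3 (0 : Fin 1) (fun _ => 0) (0, fun _ => 2) (0, fun _ => 1) = -18 := by decide
example : vhCountAt (fun _ => 1) 3 (0 : Fin 1) (fun _ => 0) (0, fun _ => 3) (0, fun _ => 1) = -18 := by decide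
example : vhCountAt (fun _ => 1) 3 (0 : Fin 1) (fun _ => 0) (0, fun _ => 1) (0, fun _ => 2) = 0 := by decide
example : vhCountAt (fun _ => 1) 3 (0 : Fin 1) (fun _ => 0) (0, fun _ => 1) (0, fun _ => 1) = 0 := by decide
example : vhCount 3 (0 : Fin 1) (fun _ => 0) (0, fun _ => 1) (0, fun _ => 0) = -18 := by decide
example : vhCount 3 (0 : Fin 1) (fun _ => 0) (0, fun _ => 0) (0, fun _ => 0) = 0 := by decide

end Toy

end Literature.MathematicalPhysics.QuantumFieldTheory.Balaban1983to89.Beta.AveragingHessianKernelsRooted
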